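import Literature.Analysis.FluidPDE.StokesTorusProofs
import Literature.Analysis.FluidPDE.StokesTorusPositivityProofs
import Literature.Analysis.FluidPDE.StatisticalSolutionProofs
import HarnessLib

/-!
# The `H¹` frame bound for `S = (1 + A)^{-1/2}` on the energy space of the flat torus

Analysis/FluidPDE support file (everything proved; no definitions, no named facts), companion of
`StokesTorusSqrtResolvent.lean`.  Let `b` be a Hilbert basis of the energy space
`H = Torus.energySpace d` consisting of Stokes modes `Torus.stokesModeL2 k a c` with symbol
`m i = 4π²|kᵢ|²`, and let `S : H →L[ℝ] H` act diagonally, `S (b i) = (1 + m i)^{-1/2} b i` — the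
frame operator `(1 + A)^{-1/2}` of the Stokes operator `A` (Constantin–Foias 1988, Ch. 4, (4.4)–(4.7),
(4.11)–(4.13): `V = D(A^{1/2})`, `‖v‖²_V = ‖v‖² + ‖A^{1/2} v‖²`).  We prove the Fourier-side
**frame bound**

  `∑_{k ∈ ℤ^d} (1 + 4π²|k|²) ‖𝓕(S y)(k)‖² ≤ ‖y‖²`        (`Torus.tsum_one_add_stokesEigenvalue_mul_enorm_sq_le`)

for every `y ∈ H` (`𝓕` the Fourier coefficients of the complexified representative of the `L²`
class `S y`), i.e. `‖S y‖²_{L²} + ‖∇(S y)‖²_{L²} ≤ ‖y‖²`: the range of `S` lies in `H¹` with the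
graph norm controlled by `‖y‖` (in fact with equality; only the inequality is consumed downstream,
by the construction of the bounded bilinear form of the mild Navier–Stokes formulation,
`StokesTorusBilinearForm.lean`).

## Proof

* `Torus.repr_frame_apply`: `⟪b i, S y⟫ = (1 + m i)^{-1/2} ⟪b i, y⟫` (expand `y = ∑ ⟪b i, y⟫ b i`,
  apply the continuous `S`, and pair with `b i`).
* `Torus.isStokesImage_sum_smul`: a finite combination `v_F = ∑_{i ∈ F} cᵢ bᵢ` of basis modes is in
  the Stokes graph with image `w_F = ∑_{i ∈ F} mᵢ cᵢ bᵢ` (`Torus.isStokesImage_stokesModeL2` and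
  linearity of the weak relation), whence `ŵ_F(k) = 4π²|k|² v̂_F(k)`
  (`Torus.IsStokesImage.mFourierCoeff_eq`) and, by Parseval,
  `∑_k (1 + 4π²|k|²) ‖v̂_F(k)‖² = ‖v_F‖² + ⟪w_F, v_F⟫ = ∑_{i ∈ F} (1 + mᵢ) cᵢ²`
  (`Torus.tsum_one_add_stokesEigenvalue_mul_enorm_sq_eq`).
* With `cᵢ = (1 + mᵢ)^{-1/2} ⟪bᵢ, y⟫` this is `∑_{i ∈ F} ⟪bᵢ, y⟫² ≤ ‖y‖²` (Bessel), and `v_F → S y`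
  in `L²`; the weighted coefficient sum is lower semicontinuous on `L²` (a supremum of finite sums
  of continuous functions, `Torus.continuous_mFourierCoeff_complexify_coe`), so the bound passes to
  the limit.

## References

* P. Constantin, C. Foias, *Navier–Stokes Equations*, Univ. Chicago Press (1988), Ch. 4,
  (4.4)–(4.7), (4.11)–(4.13), and the periodic case (4.33)–(4.37). [ConstantinFoiasNSE1988]
-/

noncomputable section

open MeasureTheory Filter UnitAddTorus
open scoped InnerProductSpace RealInnerProductSpace ENNReal Topology

namespace Literature.Analysis.FluidPDE

namespace Torus

variable {d : Type*} [Fintype d] [DecidableEq d]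

/-! ### Coefficients of the diagonal frame operator -/

omit [DecidableEq d] in
/-- **Coefficients of a diagonal operator**: if `S` is continuous linear on a Hilbert space with
Hilbert basis `b` and `S (b i) = σ i • b i`, then `⟪b i, S y⟫ = σ i ⟪b i, y⟫` for every `y`
(expand `y` in the basis, apply `S`, pair with `b i`; Halmos, *A Hilbert Space Problem Book*,
Problem 61). [folklore] -/
theorem repr_apply_of_apply_basis {ι E : Type*} [NormedAddCommGroup E] [InnerProductSpace ℝ E]
    [CompleteSpace E] (b : HilbertBasis ι ℝ E) (σ : ι → ℝ) (S : E →L[ℝ] E)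
    (hS : ∀ i, S (b i) = σ i • b i) (y : E) (i : ι) :
    b.repr (S y) i = σ i * b.repr y i := by
  classical
  have h1 : HasSum (fun j => b.repr y j • S (b j)) (S y) := by
    have h := (b.hasSum_repr y).mapL S
    simp only [ContinuousLinearMap.map_smul] at h
    exact h
  have h2 : HasSum (fun j => ⟪b i, b.repr y j • S (b j)⟫) ⟪b i, S y⟫ := h1.mapL (innerSL ℝ (b i))
  have h3 : ∀ j, ⟪b i, b.repr y j • S (b j)⟫ = if j = i then σ i * b.repr y i else 0 := by
    intro j
    rw [hS j, smul_smul, real_inner_smul_right]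
    have ho := b.orthonormal
    rw [orthonormal_iff_ite] at ho
    rw [ho i j]
    by_cases hji : j = i
    · subst hji
      simp [mul_comm]
    · rw [if_neg (Ne.symm hji), if_neg hji, mul_zero]
  simp only [h3] at h2
  rw [b.repr_apply_apply, ← h2.tsum_eq, tsum_ite_eq]

/-! ### Finite combinations of basis modes lie in the Stokes graph -/

/-- **Finite combinations of Stokes modes lie in the Stokes graph**: if every `b i` is a Stokes mode
`stokesModeL2 k a c` with `m i = 4π²|k|²`, then for every finite `F` and coefficients `c`,
`-Δ (∑_{i ∈ F} cᵢ bᵢ) = ∑_{i ∈ F} mᵢ cᵢ bᵢ` weakly (`Torus.IsStokesImage`;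
`Torus.isStokesImage_stokesModeL2` and linearity; Constantin–Foias 1988, Ch. 4, (4.36)–(4.37)).
[folklore] -/
theorem isStokesImage_sum_smul {ι : Type*} (b : HilbertBasis ι ℝ (FunctionSpaces.Torus.energySpace d))
    (m : ι → ℝ)
    (hb : ∀ i, ∃ (k : d → ℤ) (a : EuclideanSpace ℝ d) (c : Bool),
      ((b i : FunctionSpaces.Torus.energySpace d) :
          Lp (EuclideanSpace ℝ d) 2 (volume : Measure (UnitAddTorus d))) = stokesModeL2 k a c ∧
        m i = stokesEigenvalue k)
    (c : ι → ℝ) (F : Finset ι) :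
    IsStokesImage
      (((∑ i ∈ F, c i • b i : FunctionSpaces.Torus.energySpace d) :
        Lp (EuclideanSpace ℝ d) 2 (volume : Measure (UnitAddTorus d))))
      (((∑ i ∈ F, (m i * c i) • b i : FunctionSpaces.Torus.energySpace d) :
        Lp (EuclideanSpace ℝ d) 2 (volume : Measure (UnitAddTorus d)))) := by
  classical
  induction F using Finset.induction_on with
  | empty =>
    simp only [Finset.sum_empty, Submodule.coe_zero]
    exact isStokesImage_zero
  | insert i F hi ih =>
    rw [Finset.sum_insert hi, Finset.sum_insert hi, Submodule.coe_add, Submodule.coe_add]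
    refine IsStokesImage.add ?_ ih
    obtain ⟨k, a, c', hbi, hmi⟩ := hb i
    have h := (isStokesImage_stokesModeL2 (d := d) k a c').smul (c i)
    rw [← hbi, ← hmi, smul_smul, mul_comm (c i) (m i)] at h
    rw [Submodule.coe_smul, Submodule.coe_smul]
    exact h

/-! ### Parseval for a pair in the Stokes graph -/

/-- **The `V`-norm on the Fourier side**: if `v, w ∈ H` with `w = -Δ v` weakly, then
`∑_k (1 + 4π²|k|²) ‖v̂(k)‖² = ‖v‖² + ⟪w, v⟫` in `[0, ∞]` (Parseval,
`Torus.hasSum_re_inner_mFourierCoeff_inner`, and `ŵ(k) = 4π²|k|² v̂(k)`,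
`Torus.IsStokesImage.mFourierCoeff_eq`; Constantin–Foias 1988, Ch. 4, (4.4), (4.37):
`‖u‖² + (A u, u) = ∑_k (1 + 4π²|k|²)|u_k|²`). [folklore] -/
theorem tsum_one_add_stokesEigenvalue_mul_enorm_sq_eq
    {v w : Lp (EuclideanSpace ℝ d) 2 (volume : Measure (UnitAddTorus d))}
    (hv : v ∈ FunctionSpaces.Torus.energySpace d) (hw : w ∈ FunctionSpaces.Torus.energySpace d)
    (h : IsStokesImage v w) :
    ∑' k : d → ℤ, ENNReal.ofReal (1 + stokesEigenvalue k) *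
        ‖mFourierCoeff (FunctionSpaces.EuclideanSpace.complexify ∘
          (v : UnitAddTorus d → EuclideanSpace ℝ d)) k‖ₑ ^ 2 =
      ENNReal.ofReal (‖v‖ ^ 2 + ⟪w, v⟫_ℝ) := by
  set cv : (d → ℤ) → EuclideanSpace ℂ d := fun k =>
    mFourierCoeff (FunctionSpaces.EuclideanSpace.complexify ∘ (v : UnitAddTorus d → EuclideanSpace ℝ d)) k
    with hcv
  -- Parseval for `‖v‖²`
  have h1 : HasSum (fun k : d → ℤ => ‖cv k‖ ^ 2) (‖v‖ ^ 2) := by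
    have h := hasSum_re_inner_mFourierCoeff_inner v v
    rw [real_inner_self_eq_norm_sq] at h
    convert h using 1
    funext k
    rw [inner_self_eq_norm_sq_to_K]
    norm_cast
  -- Parseval for `⟪w, v⟫`
  have h2 : HasSum (fun k : d → ℤ => stokesEigenvalue k * ‖cv k‖ ^ 2) ⟪w, v⟫_ℝ := by
    have h' := hasSum_re_inner_mFourierCoeff_inner w v
    convert h' using 1
    funext k
    rw [h.mFourierCoeff_eq hv hw k, inner_smul_left, Complex.conj_ofReal, inner_self_eq_norm_sq_to_K,
      Complex.re_ofReal_mul]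
    norm_cast
  have h3 : HasSum (fun k : d → ℤ => (1 + stokesEigenvalue k) * ‖cv k‖ ^ 2) (‖v‖ ^ 2 + ⟪w, v⟫_ℝ) := by
    convert h1.add h2 using 1
    funext k
    ring
  have hnn : ∀ k : d → ℤ, 0 ≤ (1 + stokesEigenvalue k) * ‖cv k‖ ^ 2 := fun k =>
    mul_nonneg (by linarith [stokesEigenvalue_nonneg k]) (sq_nonneg _)
  rw [← h3.tsum_eq, ENNReal.ofReal_tsum_of_nonneg hnn h3.summable]
  refine tsum_congr fun k => ?_
  rw [ENNReal.ofReal_mul (by linarith [stokesEigenvalue_nonneg k]), ← ofReal_norm,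
    ENNReal.ofReal_pow (norm_nonneg _)]

/-! ### Lower semicontinuity of weighted coefficient sums on `L²` -/

omit [DecidableEq d] in
/-- A weighted sum `u ↦ ∑_k ωₖ ‖û(k)‖² ∈ [0, ∞]` (`ωₖ ≥ 0` finite) of squared Fourier coefficients is
lower semicontinuous on `L²(T^d; ℝ^d)`: it is the supremum of its finite partial sums, each
continuous (`Torus.continuous_mFourierCoeff_complexify_coe`) (Fatou for series). [folklore] -/
theorem lowerSemicontinuous_tsum_mul_enorm_sq_mFourierCoeff (ω : (d → ℤ) → ℝ) :
    LowerSemicontinuous fun u : Lp (EuclideanSpace ℝ d) 2 (volume : Measure (UnitAddTorus d)) =>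
      ∑' k : d → ℤ, ENNReal.ofReal (ω k) *
        ‖mFourierCoeff (FunctionSpaces.EuclideanSpace.complexify ∘
          (u : UnitAddTorus d → EuclideanSpace ℝ d)) k‖ₑ ^ 2 := by
  have h : (fun u : Lp (EuclideanSpace ℝ d) 2 (volume : Measure (UnitAddTorus d)) =>
      ∑' k : d → ℤ, ENNReal.ofReal (ω k) *
        ‖mFourierCoeff (FunctionSpaces.EuclideanSpace.complexify ∘
          (u : UnitAddTorus d → EuclideanSpace ℝ d)) k‖ₑ ^ 2) =
      fun u : Lp (EuclideanSpace ℝ d) 2 (volume : Measure (UnitAddTorus d)) =>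
        ⨆ s : Finset (d → ℤ), ∑ k ∈ s, ENNReal.ofReal (ω k) *
        ‖mFourierCoeff (FunctionSpaces.EuclideanSpace.complexify ∘
          (u : UnitAddTorus d → EuclideanSpace ℝ d)) k‖ₑ ^ 2 := by
    funext u
    rw [ENNReal.tsum_eq_iSup_sum]
  rw [h]
  refine lowerSemicontinuous_iSup fun s => Continuous.lowerSemicontinuous ?_
  refine continuous_finsetSum s fun k _ => ?_
  exact (ENNReal.continuous_const_mul ENNReal.ofReal_ne_top).comp
    ((ENNReal.continuous_pow 2).comp (continuous_mFourierCoeff_complexify_coe k).enorm)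

/-! ### The frame bound -/

/-- **The `H¹` frame bound for `S = (1 + A)^{-1/2}`.**  Let `b` be a Hilbert basis of
`H = Torus.energySpace d` made of Stokes modes (`b i = stokesModeL2 k a c`, `m i = 4π²|k|²`) and
`S : H →L[ℝ] H` with `S (b i) = (1 + m i)^{-1/2} b i`.  Then for every `y ∈ H`,
`∑_{k ∈ ℤ^d} (1 + 4π²|k|²) ‖𝓕(S y)(k)‖² ≤ ‖y‖²`, i.e. `‖S y‖²_{L²} + ‖∇ S y‖²_{L²} ≤ ‖y‖²`: `S` maps
`H` into `V = H ∩ H¹` with `‖S y‖_V ≤ ‖y‖` (Constantin–Foias 1988, Ch. 4, (4.4)–(4.7), (4.11)–(4.13):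
`V = D(A^{1/2})`, `A^{-1/2}` bounded; here through the finite truncations
`v_F = ∑_{i ∈ F} (1 + mᵢ)^{-1/2} ⟪bᵢ, y⟫ bᵢ`, for which the weighted sum equals `∑_{i ∈ F} ⟪bᵢ, y⟫² ≤ ‖y‖²`,
and lower semicontinuity in the limit `v_F → S y`).
[cite: ConstantinFoiasNSE1988, Ch. 4 (4.4)–(4.7), (4.11)–(4.13)] -/
theorem tsum_one_add_stokesEigenvalue_mul_enorm_sq_le {ι : Type*}
    (b : HilbertBasis ι ℝ (FunctionSpaces.Torus.energySpace d)) (m : ι → ℝ)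
    (hb : ∀ i, ∃ (k : d → ℤ) (a : EuclideanSpace ℝ d) (c : Bool),
      ((b i : FunctionSpaces.Torus.energySpace d) :
          Lp (EuclideanSpace ℝ d) 2 (volume : Measure (UnitAddTorus d))) = stokesModeL2 k a c ∧
        m i = stokesEigenvalue k)
    (S : FunctionSpaces.Torus.energySpace d →L[ℝ] FunctionSpaces.Torus.energySpace d)
    (hS : ∀ i, S (b i) = ((1 + m i) ^ (-(1 / 2 : ℝ))) • b i) (y : FunctionSpaces.Torus.energySpace d) :
    ∑' k : d → ℤ, ENNReal.ofReal (1 + stokesEigenvalue k) *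
        ‖mFourierCoeff (FunctionSpaces.EuclideanSpace.complexify ∘
          (((S y : FunctionSpaces.Torus.energySpace d) :
            Lp (EuclideanSpace ℝ d) 2 (volume : Measure (UnitAddTorus d))) :
              UnitAddTorus d → EuclideanSpace ℝ d)) k‖ₑ ^ 2 ≤
      ENNReal.ofReal (‖y‖ ^ 2) := by
  classical
  have hm0 : ∀ i, 0 ≤ m i := fun i => by
    obtain ⟨k, a, c, -, hmi⟩ := hb i
    rw [hmi]
    exact stokesEigenvalue_nonneg k
  set σ : ι → ℝ := fun i => (1 + m i) ^ (-(1 / 2 : ℝ)) with hσ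
  have hσsq : ∀ i, (1 + m i) * σ i ^ 2 = 1 := fun i => by
    have h1 : 0 < 1 + m i := by linarith [hm0 i]
    rw [hσ]
    dsimp only
    rw [← Real.rpow_natCast, ← Real.rpow_mul h1.le]
    norm_num
    rw [Real.rpow_neg_one, mul_inv_cancel₀ h1.ne']
  -- the coefficients of `S y`
  set cS : ι → ℝ := fun i => b.repr (S y) i with hcS
  have hcoef : ∀ i, cS i = σ i * b.repr y i := fun i =>
    repr_apply_of_apply_basis b σ S hS y i
  -- the weighted functional on `L²`
  set Φ : Lp (EuclideanSpace ℝ d) 2 (volume : Measure (UnitAddTorus d)) → ℝ≥0∞ := fun u =>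
    ∑' k : d → ℤ, ENNReal.ofReal (1 + stokesEigenvalue k) *
      ‖mFourierCoeff (FunctionSpaces.EuclideanSpace.complexify ∘
        (u : UnitAddTorus d → EuclideanSpace ℝ d)) k‖ₑ ^ 2 with hΦ
  -- the truncations
  set vF : Finset ι → FunctionSpaces.Torus.energySpace d := fun F => ∑ i ∈ F, cS i • b i with hvF
  have hbound : ∀ F : Finset ι,
      Φ ((vF F : FunctionSpaces.Torus.energySpace d) :
        Lp (EuclideanSpace ℝ d) 2 (volume : Measure (UnitAddTorus d))) ≤ ENNReal.ofReal (‖y‖ ^ 2) := by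
    intro F
    set wF : FunctionSpaces.Torus.energySpace d := ∑ i ∈ F, (m i * cS i) • b i with hwF
    have hgraph := isStokesImage_sum_smul b m hb cS F
    have heq := tsum_one_add_stokesEigenvalue_mul_enorm_sq_eq (vF F).2 wF.2 hgraph
    simp only [hΦ]
    rw [heq]
    refine ENNReal.ofReal_le_ofReal ?_
    -- `‖v_F‖² + ⟪w_F, v_F⟫ = ∑_{i ∈ F} (1 + m i) c_i² = ∑_{i ∈ F} ⟪b i, y⟫² ≤ ‖y‖²`
    have hn : ‖((vF F : FunctionSpaces.Torus.energySpace d) :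
        Lp (EuclideanSpace ℝ d) 2 (volume : Measure (UnitAddTorus d)))‖ ^ 2 = ∑ i ∈ F, cS i * cS i := by
      rw [← real_inner_self_eq_norm_sq, ← Submodule.coe_inner, hvF]
      dsimp only
      rw [b.orthonormal.inner_sum]
      simp
    have hi : ⟪((wF : FunctionSpaces.Torus.energySpace d) :
          Lp (EuclideanSpace ℝ d) 2 (volume : Measure (UnitAddTorus d))),
        ((vF F : FunctionSpaces.Torus.energySpace d) :
          Lp (EuclideanSpace ℝ d) 2 (volume : Measure (UnitAddTorus d)))⟫_ℝ =
        ∑ i ∈ F, m i * cS i * cS i := by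
      rw [← Submodule.coe_inner, hwF, hvF]
      dsimp only
      rw [b.orthonormal.inner_sum]
      simp
    rw [hn, hi, ← Finset.sum_add_distrib]
    have hterm : ∀ i, cS i * cS i + m i * cS i * cS i = (b.repr y i) ^ 2 := fun i => by
      rw [hcoef i]
      have := hσsq i
      calc σ i * b.repr y i * (σ i * b.repr y i) + m i * (σ i * b.repr y i) * (σ i * b.repr y i)
          = ((1 + m i) * σ i ^ 2) * (b.repr y i) ^ 2 := by ring
        _ = (b.repr y i) ^ 2 := by rw [this, one_mul]
    simp only [hterm]
    have hB := b.orthonormal.sum_inner_products_le (s := F) y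
    simp only [Real.norm_eq_abs, sq_abs, ← b.repr_apply_apply] at hB
    exact hB
  -- the limit
  have htend : Tendsto (fun F : Finset ι => ((vF F : FunctionSpaces.Torus.energySpace d) :
      Lp (EuclideanSpace ℝ d) 2 (volume : Measure (UnitAddTorus d)))) atTop
      (𝓝 ((S y : FunctionSpaces.Torus.energySpace d) :
        Lp (EuclideanSpace ℝ d) 2 (volume : Measure (UnitAddTorus d)))) := by
    have h := b.hasSum_repr (S y)
    exact (continuous_subtype_val.tendsto _).comp h
  have hclosed : IsClosed {u : Lp (EuclideanSpace ℝ d) 2 (volume : Measure (UnitAddTorus d)) |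
      Φ u ≤ ENNReal.ofReal (‖y‖ ^ 2)} :=
    (lowerSemicontinuous_tsum_mul_enorm_sq_mFourierCoeff (fun k => 1 + stokesEigenvalue k)).isClosed_preimage _
  exact hclosed.mem_of_tendsto htend (Eventually.of_forall hbound)

/-- **The `H¹` frame bound, Japanese-bracket weights**: under the hypotheses of
`Torus.tsum_one_add_stokesEigenvalue_mul_enorm_sq_le`,
`∑_{k ∈ ℤ^d} (1 + |k|²) ‖𝓕(S y)(k)‖² ≤ ‖y‖²` (`1 + |k|² ≤ 1 + 4π²|k|²`), the form consumed by the
lattice product law of `TorusLatticeProductLaw.lean`.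
[cite: ConstantinFoiasNSE1988, Ch. 4 (4.4)–(4.7), (4.11)–(4.13)] -/
theorem tsum_one_add_freqNormSq_mul_enorm_sq_le {ι : Type*}
    (b : HilbertBasis ι ℝ (FunctionSpaces.Torus.energySpace d)) (m : ι → ℝ)
    (hb : ∀ i, ∃ (k : d → ℤ) (a : EuclideanSpace ℝ d) (c : Bool),
      ((b i : FunctionSpaces.Torus.energySpace d) :
          Lp (EuclideanSpace ℝ d) 2 (volume : Measure (UnitAddTorus d))) = stokesModeL2 k a c ∧
        m i = stokesEigenvalue k)
    (S : FunctionSpaces.Torus.energySpace d →L[ℝ] FunctionSpaces.Torus.energySpace d)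
    (hS : ∀ i, S (b i) = ((1 + m i) ^ (-(1 / 2 : ℝ))) • b i) (y : FunctionSpaces.Torus.energySpace d) :
    ∑' k : d → ℤ, ENNReal.ofReal (1 + FunctionSpaces.Torus.freqNormSq k) *
        ‖mFourierCoeff (FunctionSpaces.EuclideanSpace.complexify ∘
          (((S y : FunctionSpaces.Torus.energySpace d) :
            Lp (EuclideanSpace ℝ d) 2 (volume : Measure (UnitAddTorus d))) :
              UnitAddTorus d → EuclideanSpace ℝ d)) k‖ₑ ^ 2 ≤
      ENNReal.ofReal (‖y‖ ^ 2) := by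
  refine le_trans (ENNReal.tsum_le_tsum fun k => ?_)
    (tsum_one_add_stokesEigenvalue_mul_enorm_sq_le b m hb S hS y)
  refine mul_le_mul_left (ENNReal.ofReal_le_ofReal ?_) _
  have hf := FunctionSpaces.Torus.freqNormSq_nonneg k
  have hπ : (1 : ℝ) ≤ 4 * Real.pi ^ 2 := by nlinarith [Real.two_le_pi]
  unfold stokesEigenvalue
  nlinarith

end Torus

end Literature.Analysis.FluidPDE

end
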